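import Summits.SmoothPoincare4.SmoothPoincare4.Theorems.ConvexBisectionAcyclicBisectionExistsDualHandlePlumbing
import Literature.Topology.FourManifolds.OpenCollarExistence
import Literature.Topology.FourManifolds.BoundaryGluingConstruction
import HarnessLib

/-!
# Dual handles, VI: the model chart of the glued manifold around a belt circle
(brick (ii-b) of the sub-goal T3b "the complement of the prefix sub-handlebody is the other piece
with the DUAL suffix handles" of stub `stub_steinRealisation` (NF6), line `modp-braid-orbits` r11,
crux `ConvexBisection.AcyclicBisectionExists`, item stmt-SmoothPoincare4-10508; wave 2, lead c5)

Let `X = B ∪_{h̄} (handles)` (data `D`), `M' = X ∪_Ψ W` Milnor's explicit gluing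
`G.d₂.Glued` (`BoundaryGluingConstruction.lean`) built from an open collar `G.CM` of `∂X` ADAPTED
to the belt map of the `j`-th handle (`…DualHandleGluingCollars.lean`: near the belt circle the
collar lines are the depth lines of the belt tube) and an open collar `G.CN` of `∂W`.  In Kosinski's
coordinates `x = (x_λ, x_μ) ∈ ℝ² × ℝ²` of the `j`-th handle (`D.jB j : D⁴ ∖ S → X`) the belt circle is
`b = {x_λ = 0, ‖x‖ = 1}`; this file extends the handle chart ACROSS THE SEAM near `b`:

* `seamPt D j bX x ∈ ∂X` — the boundary point under `x`: the belt-tube point of angle `x_μ/‖x_μ‖` and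
  fibre `x_λ`, i.e. the sphere point `(x_λ, (1 - ‖x_λ‖²)^{1/2} x_μ/‖x_μ‖)` of the handle;
  `seamHeight a x = (1 - ‖x‖²)/(a - 1 + ‖x‖²)` — the seam-piece height (`collarStretch a` of it is
  the depth `1 - ‖x‖²`);
* **`modelChart … x = ι (seamPt x, seamHeight a x)`** (`ι` = the seam piece `∂X × ℝ ↪ M'`), smooth
  on the model domain `{x_μ ≠ 0, ‖x_λ‖ < 1/2, |1 - ‖x‖²| small}` (`contMDiffOn_modelChart`);
* `modelChart_of_norm_le_one` — **on the `X`-side it IS the handle chart**: for `‖x‖ ≤ 1`,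
  `modelChart x = jM (D.jB j x)` (adaptedness of `G.CM` + `jM (CM z t) = ι (z, t)`);
* `modelChart_of_one_le_norm` — on the `W`-side it is the collar of `W`: for `‖x‖ ≥ 1`,
  `modelChart x = jN (CN (Ψ (seamPt x)) (-seamHeight a x))`;
* `helper_modelChart_of_norm_le_one` (registered) — the `X`-side identification in tree vocabulary.

The dual attaching map read in this chart is in `…DualHandleSeamModelDual.lean`.  After replacing
`M` by `M'` (uniqueness of gluings, `exists_diffeomorph_glued` of `…DualHandleGluingCollars.lean`),
every map of the dual presentation near the `j`-th belt circle can be written in ONE smooth chart of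
`ℝ⁴` in which the `X`-side is Kosinski's handle.  Everything here is proved; no named facts.

## References
* J. Milnor, *Lectures on the h-cobordism theorem* (1965), Thm. 1.4, §3. [MilnorHCobordism1965]
* A. A. Kosinski, *Differential Manifolds* (1993), VI §6, (6.1). [Kosinski1993]
-/

noncomputable section

-- the prescribed namespace `Summit.<P>.<Sub>.…` duplicates `SmoothPoincare4` (P = Sub)
set_option linter.dupNamespace false

open scoped Manifold ContDiff Topology

namespace Summit.SmoothPoincare4.SmoothPoincare4.Theorems.AcyclicBisectionExists.ModpBraidOrbits

open Set Function Metric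
open Literature.Topology.FourManifolds Literature.Topology.FourManifolds.HandleAttachingMap

/-! ### §1 Vectors: the `μ`-direction, the sphere point under `x`, the seam height -/

section Vectors

/-- The block swap exchanges the two inclusions: `σ (u, 0) = (0, u)`. [folklore] -/
@[simp] theorem swapIso_lamEmbed (u : EuclideanSpace ℝ (Fin 2)) : swapIso (lamEmbed u) = muEmbed u := by
  ext i; fin_cases i <;> simp [swapIso_apply_zero, swapIso_apply_one, swapIso_apply_two,
    swapIso_apply_three]

/-- The block swap exchanges the two inclusions: `σ (0, v) = (v, 0)`. [folklore] -/
@[simp] theorem swapIso_muEmbed (v : EuclideanSpace ℝ (Fin 2)) : swapIso (muEmbed v) = lamEmbed v := by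
  ext i; fin_cases i <;> simp [swapIso_apply_zero, swapIso_apply_one, swapIso_apply_two,
    swapIso_apply_three]

/-- A fixed point of the circle (junk value of the `μ`-direction at `x_μ = 0`). [folklore] -/
def circleBasePt : sphere (0 : EuclideanSpace ℝ (Fin 2)) 1 :=
  ⟨EuclideanSpace.single (0 : Fin 2) 1, mem_sphere_zero_iff_norm.2 norm_single_zero_one⟩

open Classical in
/-- **The `μ`-direction `x_μ/‖x_μ‖ ∈ S¹` of `x ∈ ℝ⁴`** (junk at `x_μ = 0`). [cite: Kosinski1993, VI §6] -/
def muDir (x : EuclideanSpace ℝ (Fin 4)) : sphere (0 : EuclideanSpace ℝ (Fin 2)) 1 :=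
  if h : muPart x = 0 then circleBasePt else
    ⟨‖muPart x‖⁻¹ • muPart x, by
      rw [mem_sphere_zero_iff_norm, norm_smul, norm_inv, norm_norm, inv_mul_cancel₀ (norm_ne_zero_iff.2 h)]⟩

/-- The `μ`-direction as a vector, off `x_μ = 0`. [folklore] -/
theorem coe_muDir {x : EuclideanSpace ℝ (Fin 4)} (hx : muPart x ≠ 0) :
    (muDir x : EuclideanSpace ℝ (Fin 2)) = ‖muPart x‖⁻¹ • muPart x := by
  rw [muDir, dif_neg hx]

/-- `‖x_μ‖ • x̂_μ = x_μ`. [folklore] -/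
theorem norm_smul_muDir {x : EuclideanSpace ℝ (Fin 4)} (hx : muPart x ≠ 0) :
    ‖muPart x‖ • (muDir x : EuclideanSpace ℝ (Fin 2)) = muPart x := by
  rw [coe_muDir hx, smul_smul, mul_inv_cancel₀ (norm_ne_zero_iff.2 hx), one_smul]

/-- **The `μ`-direction is smooth off `x_μ = 0`** (test on the open subtype, where it is the
normalised smooth vector `x_μ`, `ContMDiff.codRestrict_sphere`). [folklore] -/
theorem contMDiffOn_muDir :
    ContMDiffOn 𝓘(ℝ, EuclideanSpace ℝ (Fin 4)) (𝓡 1) ∞ muDir {x | muPart x ≠ 0} := by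
  set U : TopologicalSpace.Opens (EuclideanSpace ℝ (Fin 4)) :=
    ⟨{x | muPart x ≠ 0}, isOpen_ne.preimage contDiff_muPart.continuous⟩ with hU
  intro x hx
  apply ContMDiffAt.contMDiffWithinAt
  have key : ContMDiff 𝓘(ℝ, EuclideanSpace ℝ (Fin 4)) (𝓡 1) ∞ fun y : U => muDir (y : EuclideanSpace ℝ (Fin 4)) := by
    have h1 : ContMDiff 𝓘(ℝ, EuclideanSpace ℝ (Fin 4)) 𝓘(ℝ, EuclideanSpace ℝ (Fin 2)) ∞
        fun y : U => ‖muPart (y : EuclideanSpace ℝ (Fin 4))‖⁻¹ • muPart (y : EuclideanSpace ℝ (Fin 4)) := by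
      intro y
      have hy : muPart (y : EuclideanSpace ℝ (Fin 4)) ≠ 0 := y.2
      have h2 : ContMDiffAt 𝓘(ℝ, EuclideanSpace ℝ (Fin 4)) 𝓘(ℝ, EuclideanSpace ℝ (Fin 2)) ∞
          (fun z : EuclideanSpace ℝ (Fin 4) => muPart z) (y : EuclideanSpace ℝ (Fin 4)) :=
        contDiff_muPart.contMDiff _
      have h3 : ContDiffAt ℝ ∞ (fun u : EuclideanSpace ℝ (Fin 2) => ‖u‖⁻¹ • u) (muPart (y : EuclideanSpace ℝ (Fin 4))) :=
        ((contDiffAt_norm ℝ hy).inv (norm_ne_zero_iff.2 hy)).smul contDiffAt_id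
      exact (h3.contMDiffAt.comp _ h2).comp y (contMDiff_subtype_val y)
    haveI : Fact (Module.finrank ℝ (EuclideanSpace ℝ (Fin 2)) = 1 + 1) := ⟨by simp⟩
    refine (h1.codRestrict_sphere (n := 1) fun y => ?_).congr fun y => ?_
    · have hy : muPart (y : EuclideanSpace ℝ (Fin 4)) ≠ 0 := y.2
      rw [mem_sphere_zero_iff_norm, norm_smul, norm_inv, norm_norm, inv_mul_cancel₀ (norm_ne_zero_iff.2 hy)]
    · have hy : muPart (y : EuclideanSpace ℝ (Fin 4)) ≠ 0 := y.2
      apply Subtype.ext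
      rw [coe_muDir hy]
      rfl
  exact (contMDiffAt_subtype_iff (U := U) (x := ⟨x, hx⟩)).1 (key ⟨x, hx⟩)

/-- **The handle-sphere point under `x`**, as a vector: `σ (mkVec x̂_μ x_λ (1 - ‖x‖²)) = x` — the
depth line of the belt tube through the sphere point of angle `x̂_μ` and fibre `x_λ` passes through
`x` at depth `1 - ‖x‖²`. [cite: Kosinski1993, VI §6] -/
theorem swapIso_mkVec_muDir {x : EuclideanSpace ℝ (Fin 4)} (hx : muPart x ≠ 0) :
    swapIso (mkVec (muDir x : EuclideanSpace ℝ (Fin 2)) (lamPart x) (1 - ‖x‖ ^ 2)) = x := by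
  have h1 : 1 - (1 - ‖x‖ ^ 2) - ‖lamPart x‖ ^ 2 = ‖muPart x‖ ^ 2 := by
    rw [norm_sq_eq_lamPart_muPart]; ring
  rw [mkVec, h1, Real.sqrt_sq (norm_nonneg _), ← lamEmbed_smul, norm_smul_muDir hx, map_add,
    swapIso_lamEmbed, swapIso_muEmbed, add_comm, lamEmbed_add_muEmbed]

/-- **The seam-piece height of `x`**: `(1 - ‖x‖²)/(a - 1 + ‖x‖²)`, the parameter `s` of the long
open collar with `collarStretch a s = 1 - ‖x‖²` (the depth); negative outside the unit ball.
[cite: MilnorHCobordism1965, proof of Thm. 3.4] -/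
def seamHeight (a : ℝ) (x : EuclideanSpace ℝ (Fin 4)) : ℝ := (1 - ‖x‖ ^ 2) / (a - 1 + ‖x‖ ^ 2)

/-- `collarStretch a (seamHeight a x) = 1 - ‖x‖²` (for `1 - ‖x‖² < a`, `0 < a`). [folklore] -/
theorem collarStretch_seamHeight {a : ℝ} (ha : 0 < a) {x : EuclideanSpace ℝ (Fin 4)} (hx : 1 - ‖x‖ ^ 2 < a) :
    collarStretch a (seamHeight a x) = 1 - ‖x‖ ^ 2 := by
  have h : seamHeight a x = (1 - ‖x‖ ^ 2) / (a - (1 - ‖x‖ ^ 2)) := by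
    rw [seamHeight]; congr 1; ring
  rw [h]
  exact collarStretch_div_sub' ha hx

/-- The seam height is nonnegative on the closed unit ball (for `1 - ‖x‖² < a`). [folklore] -/
theorem seamHeight_nonneg {a : ℝ} {x : EuclideanSpace ℝ (Fin 4)} (hx : 1 - ‖x‖ ^ 2 < a) (h1 : ‖x‖ ≤ 1) :
    0 ≤ seamHeight a x := by
  have h2 : ‖x‖ ^ 2 ≤ 1 := by nlinarith [norm_nonneg x]
  exact div_nonneg (by linarith) (by linarith)

/-- The seam height is nonpositive off the open unit ball (for `1 - ‖x‖² < a`). [folklore] -/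
theorem seamHeight_nonpos {a : ℝ} {x : EuclideanSpace ℝ (Fin 4)} (hx : 1 - ‖x‖ ^ 2 < a) (h1 : 1 ≤ ‖x‖) :
    seamHeight a x ≤ 0 := by
  have h2 : 1 ≤ ‖x‖ ^ 2 := by nlinarith
  exact div_nonpos_of_nonpos_of_nonneg (by linarith) (by linarith)

/-- The seam height is smooth where `a - 1 + ‖x‖² ≠ 0`. [folklore] -/
theorem contDiffOn_seamHeight (a : ℝ) :
    ContDiffOn ℝ ∞ (seamHeight a) {x : EuclideanSpace ℝ (Fin 4) | 1 - ‖x‖ ^ 2 < a} := by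
  refine ContDiffOn.div (contDiffOn_const.sub (contDiff_norm_sq ℝ).contDiffOn)
    ((contDiffOn_const.sub contDiffOn_const).add (contDiff_norm_sq ℝ).contDiffOn) fun x hx => ?_
  simp only [mem_setOf_eq] at hx
  show a - 1 + ‖x‖ ^ 2 ≠ 0
  linarith

end Vectors

/-! ### §2 The seam point under `x` and the model chart -/

section Chart

variable {B : Type} [TopologicalSpace B] [T2Space B] [ChartedSpace (EuclideanHalfSpace 4) B]
  {ι : Type} [Finite ι] {h : ι → HandleAttachingMap 3 2 B}
  {X : Type} [TopologicalSpace X] [ChartedSpace (EuclideanHalfSpace 4) X] [IsManifold (𝓡∂ 4) ∞ X]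
  (D : MultiAttachmentData h (𝓡∂ 4) X) (j : ι) (bX : BoundaryData (𝓡∂ 4) X (𝓡 3))

/-- **The seam point under `x`**: the belt-tube point of the `j`-th handle with angle `x̂_μ` and
fibre `x_λ` (the boundary tube `(beltMap D j).boundaryTube` of `AttachingMapBoundaryTube.lean`),
read in the boundary datum `bX` (`BoundaryData.restrictDiffeomorph` of the identity).  Its
underlying point of `X` is `D.jB j (x_λ, (1 - ‖x_λ‖²)^{1/2} x̂_μ)` (`incl_seamPt`). [cite: Kosinski1993, VI §6] -/
def seamPt (x : EuclideanSpace ℝ (Fin 4)) : bX.carrier :=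
  (BoundaryManifold.boundaryData 3 X).restrictDiffeomorph bX (Diffeomorph.refl (𝓡∂ 4) X ∞)
    ((beltMap D j).boundaryTube.toHomeo (muDir x, lamPart x))

/-- The seam point as a point of `X`: the belt map at the sphere point `depthLine x̂_μ x_λ 0`.
[folklore] -/
theorem incl_seamPt (x : EuclideanSpace ℝ (Fin 4)) :
    bX.incl (seamPt D j bX x) = (beltMap D j).toFun (depthLine (muDir x) (lamPart x) 0) := by
  rw [seamPt, incl_restrict_refl]
  rfl

/-- **The seam point is smooth** on `{x_μ ≠ 0, ‖x_λ‖ < 1}`. [folklore] -/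
theorem contMDiffOn_seamPt :
    ContMDiffOn 𝓘(ℝ, EuclideanSpace ℝ (Fin 4)) (𝓡 3) ∞ (seamPt D j bX)
      {x | muPart x ≠ 0 ∧ ‖lamPart x‖ < 1} := by
  have h1 : ContMDiffOn 𝓘(ℝ, EuclideanSpace ℝ (Fin 4)) ((𝓡 1).prod 𝓘(ℝ, EuclideanSpace ℝ (Fin 2))) ∞
      (fun x => (muDir x, lamPart x)) {x | muPart x ≠ 0 ∧ ‖lamPart x‖ < 1} :=
    (contMDiffOn_muDir.mono fun x hx => hx.1).prodMk contDiff_lamPart.contMDiff.contMDiffOn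
  have h2 := ((beltMap D j).boundaryTube.contMDiffOn_toHomeo).comp h1 fun x hx => by
    rw [(beltMap D j).boundaryTube.source_eq]
    exact ⟨mem_univ _, mem_ball_zero_iff.2 hx.2⟩
  exact ((BoundaryManifold.boundaryData 3 X).restrictDiffeomorph bX
    (Diffeomorph.refl (𝓡∂ 4) X ∞)).contMDiff.comp_contMDiffOn h2

variable {W : Type} [TopologicalSpace W] [ChartedSpace (EuclideanHalfSpace 4) W]
  [IsManifold (𝓡∂ 4) ∞ W] {bW : BoundaryData (𝓡∂ 4) W (𝓡 3)} [Nonempty bX.carrier]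

variable {bX} in
/-- **THE MODEL CHART of `M' = X ∪_Ψ W` around the `j`-th belt circle**: `x ↦ ι (seamPt x,
seamHeight a x)`, `ι : ∂X × ℝ ↪ M'` the seam piece of Milnor's gluing (`G.d₂.inl ∘ G.d₁.inl`).
[cite: MilnorHCobordism1965, Thm. 1.4] -/
def modelChart (G : BoundaryGlueData bX bW) (a : ℝ) (x : EuclideanSpace ℝ (Fin 4)) : G.d₂.Glued :=
  G.d₂.inl (G.d₁.inl (seamPt D j bX x, seamHeight a x))

/-- **The model chart is smooth** on `{x_μ ≠ 0, ‖x_λ‖ < 1, 1 - ‖x‖² < a}`. [folklore] -/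
theorem contMDiffOn_modelChart (G : BoundaryGlueData bX bW) (a : ℝ) :
    ContMDiffOn 𝓘(ℝ, EuclideanSpace ℝ (Fin 4)) (𝓡 4) ∞ (modelChart D j G a)
      {x | muPart x ≠ 0 ∧ ‖lamPart x‖ < 1 ∧ 1 - ‖x‖ ^ 2 < a} := by
  have h1 : ContMDiffOn 𝓘(ℝ, EuclideanSpace ℝ (Fin 4)) ((𝓡 3).prod 𝓘(ℝ, ℝ)) ∞
      (fun x => (seamPt D j bX x, seamHeight a x)) {x | muPart x ≠ 0 ∧ ‖lamPart x‖ < 1 ∧ 1 - ‖x‖ ^ 2 < a} :=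
    ((contMDiffOn_seamPt D j bX).mono fun x hx => ⟨hx.1, hx.2.1⟩).prodMk
      ((contDiffOn_seamHeight a).contMDiffOn.mono fun x hx => hx.2.2)
  exact (G.d₂.contMDiff_inl.comp G.d₁.contMDiff_inl).comp_contMDiffOn h1

/-- **On the `X`-side the model chart IS the handle chart.**  If the open collar `G.CM` of `∂X` is
adapted to the belt map of the `j`-th handle (`exists_openCollar_adapted`), then for `x` with
`x_μ ≠ 0`, `‖x_λ‖ ≤ 1/2`, `‖x‖ ≤ 1` and depth `1 - ‖x‖² ≤ min (1/5) a`: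
`modelChart x = jM (D.jB j x)`.  (`jM (CM z s) = ι (z, s)`, the collar line through `seamPt x` is
the depth line, which passes through `x` at depth `collarStretch a s = 1 - ‖x‖²`.)
[cite: Kosinski1993, VI §6] -/
theorem modelChart_of_norm_le_one (G : BoundaryGlueData bX bW) {a : ℝ} (ha : 0 < a)
    (hCM : ∀ (θ : sphere (0 : EuclideanSpace ℝ (Fin 2)) 1) (v : EuclideanSpace ℝ (Fin 2)), ‖v‖ ≤ 1 / 2 →
      ∀ z : bX.carrier, bX.incl z = (beltMap D j).toFun (depthLine θ v 0) →
      ∀ s : ℝ, 0 ≤ s → collarStretch a s ≤ min (1 / 5) a →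
        G.CM.toFun z s = (beltMap D j).toFun (depthLine θ v (collarStretch a s)))
    {x : EuclideanSpace ℝ (Fin 4)} (hμ : muPart x ≠ 0) (hlam : ‖lamPart x‖ ≤ 1 / 2) (h1 : ‖x‖ ≤ 1)
    (hd : 1 - ‖x‖ ^ 2 ≤ min (1 / 5) a) (hda : 1 - ‖x‖ ^ 2 < a) :
    modelChart D j G a x =
      G.jM (D.jB j ⟨⟨x, mem_closedBall_zero_iff.2 h1⟩, by
        rw [mem_beltPiece, ← norm_lamPart_sq]
        intro h; nlinarith [norm_nonneg (lamPart x)]⟩) := by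
  have hs : 0 ≤ seamHeight a x := seamHeight_nonneg hda h1
  rw [modelChart, ← G.jM_toFun (seamPt D j bX x) hs]
  congr 1
  rw [hCM (muDir x) (lamPart x) hlam (seamPt D j bX x) (incl_seamPt D j bX x) _ hs
    (by rw [collarStretch_seamHeight ha hda]; exact hd), beltMap_apply]
  congr 1
  apply Subtype.ext; apply Subtype.ext
  have hpos : 0 < 1 - collarStretch a (seamHeight a x) - ‖lamPart x‖ ^ 2 := by
    rw [collarStretch_seamHeight ha hda]
    have : 1 - (1 - ‖x‖ ^ 2) - ‖lamPart x‖ ^ 2 = ‖muPart x‖ ^ 2 := by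
      rw [norm_sq_eq_lamPart_muPart]; ring
    rw [this]
    exact pow_pos (norm_pos_iff.2 hμ) 2
  rw [coe_coe_swapTube, ← tubeVec_mk, tubeVec_depthLine _ _ (collarStretch_nonneg ha hs) hpos,
    collarStretch_seamHeight ha hda]
  exact swapIso_mkVec_muDir hμ

/-- **On the `W`-side the model chart is the collar of `W`**: for `1 ≤ ‖x‖` (and `1 - ‖x‖² < a`),
`modelChart x = jN (CN (Ψ (seamPt x)) (-seamHeight a x))` (`jN (CN (Ψ z) s) = ι (z, -s)`).
[cite: MilnorHCobordism1965, Thm. 1.4] -/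
theorem modelChart_of_one_le_norm (G : BoundaryGlueData bX bW) {a : ℝ}
    {x : EuclideanSpace ℝ (Fin 4)} (h1 : 1 ≤ ‖x‖) (hda : 1 - ‖x‖ ^ 2 < a) :
    modelChart D j G a x = G.jN (G.CN.toFun (G.φ (seamPt D j bX x)) (-seamHeight a x)) := by
  rw [G.jN_toFun (seamPt D j bX x) (neg_nonneg.2 (seamHeight_nonpos hda h1)), neg_neg]
  rfl

/-- **Registered helper `helper_modelChart_of_norm_le_one` (brick (ii-b) of T3b, sub-goal of NF6
`stub_steinRealisation`, wave 2, lead c5): on the `X`-side the model chart of Milnor's gluing around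
the `j`-th belt circle IS Kosinski's handle chart** (for an open collar of `∂X` adapted to the belt
map). [cite: Kosinski1993, VI §6] -/
theorem helper_modelChart_of_norm_le_one : ∀ {B : Type} [TopologicalSpace B] [T2Space B] [ChartedSpace (EuclideanHalfSpace 4) B] {ι : Type} [Finite ι] {h : ι → Literature.Topology.FourManifolds.HandleAttachingMap 3 2 B} {X : Type} [TopologicalSpace X] [ChartedSpace (EuclideanHalfSpace 4) X] [IsManifold (𝓡∂ 4) ∞ X] (D : Literature.Topology.FourManifolds.HandleAttachingMap.MultiAttachmentData h (𝓡∂ 4) X) (j : ι) {bX : Literature.Topology.FourManifolds.BoundaryData (𝓡∂ 4) X (𝓡 3)} {W : Type} [TopologicalSpace W] [ChartedSpace (EuclideanHalfSpace 4) W] [IsManifold (𝓡∂ 4) ∞ W] {bW : Literature.Topology.FourManifolds.BoundaryData (𝓡∂ 4) W (𝓡 3)} [Nonempty bX.carrier] (G : Literature.Topology.FourManifolds.BoundaryGlueData bX bW) (a : ℝ), 0 < a → (∀ (θ : Metric.sphere (0 : EuclideanSpace ℝ (Fin 2)) 1) (v : EuclideanSpace ℝ (Fin 2)), ‖v‖ ≤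 1 / 2 → ∀ z : bX.carrier, bX.incl z = (Summit.SmoothPoincare4.SmoothPoincare4.Theorems.AcyclicBisectionExists.ModpBraidOrbits.beltMap D j).toFun (Literature.Topology.FourManifolds.depthLine θ v 0) → ∀ s : ℝ, 0 ≤ s → Literature.Topology.FourManifolds.collarStretch a s ≤ min (1 / 5) a → G.CM.toFun z s = (Summit.SmoothPoincare4.SmoothPoincare4.Theorems.AcyclicBisectionExists.ModpBraidOrbits.beltMap D j).toFun (Literature.Topology.FourManifolds.depthLine θ v (Literature.Topology.FourManifolds.collarStretch a s))) → ∀ (x : EuclideanSpace ℝ (Fin 4)) (b : ↥(Literature.Topology.FourManifolds.beltPiece 3 2)), ((b : Metric.closedBall (0 : EuclideanSpace ℝ (Fin 4)) 1) : EuclideanSpace ℝ (Fin 4)) = x → Literature.Topology.FourManifolds.muPart x ≠ 0 → ‖Literature.Topology.FourManifolds.lamPart x‖ ≤ 1 / 2 → 1 - ‖x‖ ^ 2 ≤ min (1 / 5) a → 1 - ‖x‖ ^ 2 < a → Summit.SmoothPoincare4.SmoothPoincare4.Theorems.AcyclicBisectionExists.ModpBraidOrbits.modelChart D j G a x = G.jM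 (D.jB j b) := by
  intro B _ _ _ ι _ h X _ _ _ D j bX W _ _ _ bW _ G a ha hCM x b hb hμ hlam hd hda
  subst hb
  rw [modelChart_of_norm_le_one D j bX G ha hCM hμ hlam (mem_closedBall_zero_iff.1 b.1.2) hd hda]

end Chart


end Summit.SmoothPoincare4.SmoothPoincare4.Theorems.AcyclicBisectionExists.ModpBraidOrbits

end
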